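import Summits.QuantumFields.YangMills.Theorems.UnitScaleTiltProp7Prop4OfW80RowsAtRecord
import Summits.QuantumFields.YangMills.Theorems.UnitScaleTiltProp7ThetaOfColumnLettersPi
import HarnessLib

/-!
# Route `UnitScaleTilt`, crux K1 child «MinimiserStabilityRegPr» (stmt-QuantumFields-19200), skeleton v10, stub `stub_existenceMinimalOrbit` (EX), route (α) — **THE «THETA-OF-W6» DOOR:
# the three kernel-column rows `hΘE hΘ′ hΘ3` displayed by ★px5 g3's PROP4-W80 door (✓p683940 `Prop7Prop4OfW80RowsAtRecord.prop4_W80_family`, lit ✓`quadAnalytic_W80_composite` :189–195 at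
# the (W-X′) letters of record) DESCENDED to the three one-block∕one-bond LETTERS they are made of — the fine column of `H̃ᴾ` ([5] (3.133)), the fine column of `Δ̃π∘H̃ᴾ` ([B11] (88)),
# the coarse column of `C̃′` ([4] (157)) — with the volume factors `L^{±3(K−n)}` DISPLAYED and one numeric Neumann window; `θE θE′ θ₃` WRITTEN OUT**

Cell `ym3-torus`, width seat `ym3-torus-px6` (gen 4); EX namer ★ym-ust-19200-w2 g7 WORDS (13)∕(16) 2026-08-29 «THETA-OF-W6»; LOCATE HOME `ym3-torus-px6/g4/LOCATE-THETA-OF-W6-px6g4.md`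
(46e408e5f8be67a4).  THEOREMS ONLY (0 `def`, 0 `sorry`).  CONDITIONAL door: the three letters stay displayed hypotheses with located print suppliers; `--supports stmt-QuantumFields-19200
--as helper`, count-neutral.  YM₃ on T³ is a ladder rung (R3), not the Clay problem; nothing here claims the stub, the crux, d = 4 or the mass gap.

MECHANISM.  ✓`Prop7ThetaOfColumnLettersPi` (p684111): `H̃ᴾ = H1f … := (H1CLM … (HT …)).comp piIsoNegSize0` by definition, `Emap`∕`E3` are invariant under moving the bridge to `C̃`,
so lit's three carriers (✓`B11Eq73KernelColumnsCarrier.colSum_weighted_kernel_fderiv_Emap_le`, ✓`B11Eq88KernelColumnsComposite.colSum_weighted_comp_fderiv_Emap_le`,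
✓`B11Rem289KernelColumnsTheta3.colSum_weighted_kernel_fderiv_E3_le`) apply at the letters with every hypothesis read on plain `Pi` block fields.  At the member all (115)∕(−3)
weights are `1` (`(L^{K−n}·(L⁻¹)^{K−n})^s`, `levWeight_member_eq_one`), so `Θ_H^w = Θ_H` and the weight ratios drop.  The member's column letters carry the volume: the fine column of a
one-block kernel is `≍ L^{3(K−n)}` (units `L^jη = 1`), the (157)-class coarse column of `C̃′` is `≍ L^{−3(K−n)}`; the door displays them as `ΘH L·V`, `ΘΔ L·V`, `G L·V⁻¹`, `V := (L^{K−n})³`,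
and only the products `ΘH·G`, `ΘΔ·G` enter `θE θE′ θ₃` and the window.

WHAT IS PROVED (ns `…Theorems.Prop7ThetaOfColumnLettersT3`).
* §1 `levWeight_member_eq_one`, member theorems ★★`thetaE_member`, ★★`thetaPrime_member`, ★★`theta3_member` (letters `(F, n, K, h, c₀, cB, a, U₀)`; member numbers `ΘH ΘΔ G`).
* §2 ★★★ `theta_rows_family_of_columnLetters` — CONCLUSION: ✓p683940's three binders `hΘE ∧ hΘ′ ∧ hΘ3` VERBATIM at
  `θE L := 2·ΘH L·G L·ℓ L`, `θE′ L := 2·ΘΔ L·G L·ℓ L`, `θ₃ L := (2·ℓ L + 1)·(ΘH L·G L)∕a₃ L`, `ℓ L := 1∕(1 − 4·bH L·C₂(L)·(εC L + a₃ L))`, `C₂(L) := 40·(2·(3·(2·ef L + 2700·L·α L)))∕(ef L)²`;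
  HYPOTHESES: `hRC` (✓p683940's, VERBATIM; inhabited at `bH := B₀` by ✓p682625), windows `hα ha₃ hef hWe hWε` (Prop. 3's `hC` is DISCHARGED inside by ✓p664073
  `prop4Hyp_CmapTwS_conj_zeroJet`), signs `hΘH0 hΘΔ0`, the window `hqΘ : (εC L + a₃ L)·ΘH L·G L ≤ ½`, and the THREE DISPLAYED LETTER ROWS
  «H-COLUMN» `hHcol` (∃ one-block letter `hk ≥ 0` of `H̃ᴾ` on `Pi.single`, fine column sums `≤ ΘH L·V`), «C-COLUMN» `hCcol` (∃ one-bond letter `gC ≥ 0` of `C̃′` on `‖A‖ < εC + a₃`, coarse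
  column sums `≤ G L·V⁻¹` — inhabitant = ★px18 F2∕F3 ✓p665268∕p665655 + the (157) entry row), «ΔH-COLUMN» `hΔHcol` (∃ one-block letter `hk′ ≥ 0` of `Δ̃π∘H̃ᴾ`, fine column sums `≤ ΘΔ L·V`).
HONEST SCOPE.  Re-lettering only: every estimate is lit's Neumann majorant; (3.133)∕(88)∕(157) are genuine open N06-class rows (the (157) letter for the symmetric-stair chart is supported
numerically only, px18 g2 157-LOCATE v2.1); nothing of EX, the stub or the crux is claimed.

References: T. Bałaban, CMP 102 (1985) 277–309 [Balaban1985Variational] ((63) p.287, (68)–(73) pp.288–289, (85)–(88) p.291, Prop. 4 (97)–(98) pp.292–293, (115) p.294); CMP 99 (1985)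
389–434 [Balaban1985BackgroundPropagators] ((3.132)–(3.133) p.423); CMP 98 (1985) 17–51 [Balaban1985Averaging] (Prop. 5 (157) p.42).
-/

set_option autoImplicit false

noncomputable section

open scoped InnerProductSpace ComplexConjugate Matrix.Norms.L2Operator BigOperators

namespace Summit.QuantumFields.YangMills.Theorems.Prop7ThetaOfColumnLettersT3

open Literature.MathematicalPhysics.QuantumFieldTheory.Balaban1983to89
open Literature.MathematicalPhysics.QuantumFieldTheory.Balaban1983to89.T3ContinuumYM3Torus
open Literature.MathematicalPhysics.QuantumFieldTheory.Balaban1983to89.T3Thm1Carrier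
open T3SectALandauChart (eta eta_pos)
open T3PrintedRegularMinimiser (RegPr)
open T3PrintedMinimiserExistence (regPr_mono)
open B9SectCLatticeCarrier (Bond)
open B11Eq115Space (NegSup NegSize Space115 JetSup levWeight levWeight_apply)
open B11Eq111FrakG (nabla115)
open B11Eq174Chart (Regime)
open B11Prop6Scheme (Prop4Hyp)
open B11Eq80Current (Emap E3)
open B11Eq90Transpose (kernel single115)
open B11Eq90V0primeCurrent (flat115)
open B9Eq3119DeltaPiCarrier (currentCLM)
open Summit.QuantumFields.YangMills.Theorems.Prop7SectET3Transport (periodsT3 bondEquiv bgOfCfg piIsoNegSize0)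
open Summit.QuantumFields.YangMills.Theorems.Prop7SectET3HilbertLetters (W₂ frobEquiv)
open Summit.QuantumFields.YangMills.Theorems.Prop7SectET3CurvedPropagators (H1f)
open Summit.QuantumFields.YangMills.Theorems.Prop7SectET3WilsonHessian (DeltaEtaSlot)
open Summit.QuantumFields.YangMills.Theorems.Prop7SectET3DeltaPiPInv (DeltaPiSlotP)
open Summit.QuantumFields.YangMills.Theorems.Prop7SymAvgTwSym (CmapTwS)
open Summit.QuantumFields.YangMills.Theorems.Prop7SectET3WCurrentProp4Rows (prop4Hyp_CmapTwS_conj_zeroJet)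
open Summit.QuantumFields.YangMills.Theorems.Prop7ThetaOfColumnLettersPi (thetaE_row thetaPrime_row theta3_row)

/-! ## §1 The member: weights `1`, the three rows from member letters -/

/-- **THE ROUTE'S ONE-LEVEL (115) WEIGHT IS `1`**: `((L^{K−n})·(L⁻¹)^{K−n})^s = 1` (print p.300 «j = k», `Lᵏη = 1`). [cite: Balaban1985Variational, (115) p.294, p.300] -/
theorem levWeight_member_eq_one {ι : Type*} {Lr : ℝ} (hL : Lr ≠ 0) (k s : ℕ) (x : ι) :
    levWeight Lr ((Lr⁻¹) ^ k) (fun _ : ι => k) s x = 1 := by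
  rw [levWeight_apply, ← mul_pow, mul_inv_cancel₀ hL, one_pow, one_pow]

/-- ★★ **ROW `hΘE` AT THE MEMBER** from the member's letters (`Θ_H`, `G` the member's NUMBERS — volume included): `θE = 2Θ_HGℓ`.
[cite: Balaban1985Variational, (68)–(73) pp.288–289, (86) p.291] -/
theorem thetaE_member
    (F : T3Family) (n K : ℕ) (h : n ≤ K) [Fact (0 < (F.L : ℝ))] [Fact (0 < ((F.L : ℝ)⁻¹) ^ (K - n))]
    (c₀ cB aa : ℝ) [Fact (0 < c₀)] [Fact (0 < cB)] (U₀ : GaugeField (F.P K) 0 (Matrix.specialUnitaryGroup (Fin 2) ℂ))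
    {bH C₂ c₄ aC εC : ℝ}
    (RC : Regime (H1f F n K h c₀ cB aa (DeltaPiSlotP F n K h c₀ cB aa) U₀) 0
        (fun A' : Space115 (F.L : ℝ) (((F.L : ℝ)⁻¹) ^ (K - n)) (fun _ : Bond 3 (periodsT3 F K) => K - n) (fun _ : Bond 3 (periodsT3 F K) × Fin 3 => K - n) (nabla115 (((F.L : ℝ)⁻¹) ^ (K - n)) (bgOfCfg F K U₀)) =>
          (-Complex.I) • CmapTwS F n K h U₀ (((((eta F n K : ℝ) : ℂ)) * Complex.I) • (fun b : PBond (F.P K) 0 => JetSup.equiv _ _ _ A' (bondEquiv F K b))))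
        bH 0 C₂ c₄ 0 aC εC)
    (hC : Prop4Hyp
        (fun A' : Space115 (F.L : ℝ) (((F.L : ℝ)⁻¹) ^ (K - n)) (fun _ : Bond 3 (periodsT3 F K) => K - n) (fun _ : Bond 3 (periodsT3 F K) × Fin 3 => K - n) (nabla115 (((F.L : ℝ)⁻¹) ^ (K - n)) (bgOfCfg F K U₀)) =>
          (-Complex.I) • CmapTwS F n K h U₀ (((((eta F n K : ℝ) : ℂ)) * Complex.I) • (fun b : PBond (F.P K) 0 => JetSup.equiv _ _ _ A' (bondEquiv F K b)))) C₂ c₄)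
    {hk : Bond 3 (periodsT3 F K) → PBond (F.P n) 0 → ℝ} (hk0 : ∀ b' y, 0 ≤ hk b' y)
    (hHk : ∀ (y : PBond (F.P n) 0) (Z : Matrix (Fin 2) (Fin 2) ℂ) (b' : Bond 3 (periodsT3 F K)), ‖flat115 ((H1f F n K h c₀ cB aa (DeltaPiSlotP F n K h c₀ cB aa) U₀) (Pi.single y Z)) b'‖ ≤ hk b' y * ‖Z‖)
    {ΘH : ℝ} (hΘH : 0 ≤ ΘH) (hH1 : ∀ y : PBond (F.P n) 0, ∑ b' : Bond 3 (periodsT3 F K), hk b' y ≤ ΘH)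
    {gC : PBond (F.P n) 0 → Bond 3 (periodsT3 F K) → ℝ} (hgC0 : ∀ y bb, 0 ≤ gC y bb)
    (hCg : ∀ A : Space115 (F.L : ℝ) (((F.L : ℝ)⁻¹) ^ (K - n)) (fun _ : Bond 3 (periodsT3 F K) => K - n) (fun _ : Bond 3 (periodsT3 F K) × Fin 3 => K - n) (nabla115 (((F.L : ℝ)⁻¹) ^ (K - n)) (bgOfCfg F K U₀)), ‖A‖ < εC + aC → ∀ (bb : Bond 3 (periodsT3 F K)) (X : Matrix (Fin 2) (Fin 2) ℂ) (y : PBond (F.P n) 0),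
      ‖fderiv ℂ (fun A' : Space115 (F.L : ℝ) (((F.L : ℝ)⁻¹) ^ (K - n)) (fun _ : Bond 3 (periodsT3 F K) => K - n) (fun _ : Bond 3 (periodsT3 F K) × Fin 3 => K - n) (nabla115 (((F.L : ℝ)⁻¹) ^ (K - n)) (bgOfCfg F K U₀)) =>
          (-Complex.I) • CmapTwS F n K h U₀ (((((eta F n K : ℝ) : ℂ)) * Complex.I) • (fun b : PBond (F.P K) 0 => JetSup.equiv _ _ _ A' (bondEquiv F K b)))) A (single115 bb X) y‖ ≤ gC y bb * ‖A‖ * ‖X‖)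
    {G : ℝ} (hG : ∀ bb : Bond 3 (periodsT3 F K), ∑ y : PBond (F.P n) 0, gC y bb ≤ G) (hq : (εC + aC) * ΘH * G ≤ 1 / 2)
    {A' : Space115 (F.L : ℝ) (((F.L : ℝ)⁻¹) ^ (K - n)) (fun _ : Bond 3 (periodsT3 F K) => K - n) (fun _ : Bond 3 (periodsT3 F K) × Fin 3 => K - n) (nabla115 (((F.L : ℝ)⁻¹) ^ (K - n)) (bgOfCfg F K U₀))} (hA' : ‖A'‖ < aC) (bb : Bond 3 (periodsT3 F K)) :
    ∑ b' : Bond 3 (periodsT3 F K), levWeight (F.L : ℝ) (((F.L : ℝ)⁻¹) ^ (K - n)) (fun _ : Bond 3 (periodsT3 F K) => K - n) 3 bb / levWeight (F.L : ℝ) (((F.L : ℝ)⁻¹) ^ (K - n)) (fun _ : Bond 3 (periodsT3 F K) => K - n) 3 b' * ‖kernel (fderiv ℂ (Emap (H1f F n K h c₀ cB aa (DeltaPiSlotP F n K h c₀ cB aa) U₀) (fun A' : Space115 (F.L : ℝ) (((F.L : ℝ)⁻¹) ^ (K - n)) (fun _ : Bond 3 (periodsT3 F K) => K - n) (fun _ :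 Bond 3 (periodsT3 F K) × Fin 3 => K - n) (nabla115 (((F.L : ℝ)⁻¹) ^ (K - n)) (bgOfCfg F K U₀)) =>
          (-Complex.I) • CmapTwS F n K h U₀ (((((eta F n K : ℝ) : ℂ)) * Complex.I) • (fun b : PBond (F.P K) 0 => JetSup.equiv _ _ _ A' (bondEquiv F K b)))) εC) A') b' bb‖
      ≤ 2 * ΘH * G * (1 / (1 - 4 * bH * C₂ * (εC + aC))) * ‖A'‖ := by
  have hL0 : (F.L : ℝ) ≠ 0 := ne_of_gt Fact.out
  have hw : ∀ (s : ℕ) (b : Bond 3 (periodsT3 F K)), levWeight (F.L : ℝ) (((F.L : ℝ)⁻¹) ^ (K - n)) (fun _ : Bond 3 (periodsT3 F K) => K - n) s b = 1 := fun s b => levWeight_member_eq_one hL0 (K - n) s b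
  have hHw : ∀ (bb : Bond 3 (periodsT3 F K)) (y : PBond (F.P n) 0), ∑ b' : Bond 3 (periodsT3 F K), levWeight (F.L : ℝ) (((F.L : ℝ)⁻¹) ^ (K - n)) (fun _ : Bond 3 (periodsT3 F K) => K - n) 3 bb / levWeight (F.L : ℝ) (((F.L : ℝ)⁻¹) ^ (K - n)) (fun _ : Bond 3 (periodsT3 F K) => K - n) 3 b' * hk b' y ≤ ΘH := by
    intro bb y; simp_rw [hw, div_one, one_mul]; exact hH1 y
  exact thetaE_row (fun _ : PBond (F.P n) 0 => K - n) RC hC hk0 hHk hΘH hH1 hΘH hHw hgC0 hCg hG hq hA' bb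

/-- ★★ **ROW `hΘ3` AT THE MEMBER**: `θ₃ = (2ℓ+1)Θ_HG∕a_C`. [cite: Balaban1985Variational, p.289 (after Prop. 3), (73) p.289, (86) p.291] -/
theorem theta3_member
    (F : T3Family) (n K : ℕ) (h : n ≤ K) [Fact (0 < (F.L : ℝ))] [Fact (0 < ((F.L : ℝ)⁻¹) ^ (K - n))]
    (c₀ cB aa : ℝ) [Fact (0 < c₀)] [Fact (0 < cB)] (U₀ : GaugeField (F.P K) 0 (Matrix.specialUnitaryGroup (Fin 2) ℂ))
    {bH C₂ c₄ aC εC : ℝ}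
    (RC : Regime (H1f F n K h c₀ cB aa (DeltaPiSlotP F n K h c₀ cB aa) U₀) 0
        (fun A' : Space115 (F.L : ℝ) (((F.L : ℝ)⁻¹) ^ (K - n)) (fun _ : Bond 3 (periodsT3 F K) => K - n) (fun _ : Bond 3 (periodsT3 F K) × Fin 3 => K - n) (nabla115 (((F.L : ℝ)⁻¹) ^ (K - n)) (bgOfCfg F K U₀)) =>
          (-Complex.I) • CmapTwS F n K h U₀ (((((eta F n K : ℝ) : ℂ)) * Complex.I) • (fun b : PBond (F.P K) 0 => JetSup.equiv _ _ _ A' (bondEquiv F K b))))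
        bH 0 C₂ c₄ 0 aC εC)
    (hC : Prop4Hyp
        (fun A' : Space115 (F.L : ℝ) (((F.L : ℝ)⁻¹) ^ (K - n)) (fun _ : Bond 3 (periodsT3 F K) => K - n) (fun _ : Bond 3 (periodsT3 F K) × Fin 3 => K - n) (nabla115 (((F.L : ℝ)⁻¹) ^ (K - n)) (bgOfCfg F K U₀)) =>
          (-Complex.I) • CmapTwS F n K h U₀ (((((eta F n K : ℝ) : ℂ)) * Complex.I) • (fun b : PBond (F.P K) 0 => JetSup.equiv _ _ _ A' (bondEquiv F K b)))) C₂ c₄)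
    {hk : Bond 3 (periodsT3 F K) → PBond (F.P n) 0 → ℝ} (hk0 : ∀ b' y, 0 ≤ hk b' y)
    (hHk : ∀ (y : PBond (F.P n) 0) (Z : Matrix (Fin 2) (Fin 2) ℂ) (b' : Bond 3 (periodsT3 F K)), ‖flat115 ((H1f F n K h c₀ cB aa (DeltaPiSlotP F n K h c₀ cB aa) U₀) (Pi.single y Z)) b'‖ ≤ hk b' y * ‖Z‖)
    {ΘH : ℝ} (hΘH : 0 ≤ ΘH) (hH1 : ∀ y : PBond (F.P n) 0, ∑ b' : Bond 3 (periodsT3 F K), hk b' y ≤ ΘH)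
    {gC : PBond (F.P n) 0 → Bond 3 (periodsT3 F K) → ℝ} (hgC0 : ∀ y bb, 0 ≤ gC y bb)
    (hCg : ∀ A : Space115 (F.L : ℝ) (((F.L : ℝ)⁻¹) ^ (K - n)) (fun _ : Bond 3 (periodsT3 F K) => K - n) (fun _ : Bond 3 (periodsT3 F K) × Fin 3 => K - n) (nabla115 (((F.L : ℝ)⁻¹) ^ (K - n)) (bgOfCfg F K U₀)), ‖A‖ < εC + aC → ∀ (bb : Bond 3 (periodsT3 F K)) (X : Matrix (Fin 2) (Fin 2) ℂ) (y : PBond (F.P n) 0),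
      ‖fderiv ℂ (fun A' : Space115 (F.L : ℝ) (((F.L : ℝ)⁻¹) ^ (K - n)) (fun _ : Bond 3 (periodsT3 F K) => K - n) (fun _ : Bond 3 (periodsT3 F K) × Fin 3 => K - n) (nabla115 (((F.L : ℝ)⁻¹) ^ (K - n)) (bgOfCfg F K U₀)) =>
          (-Complex.I) • CmapTwS F n K h U₀ (((((eta F n K : ℝ) : ℂ)) * Complex.I) • (fun b : PBond (F.P K) 0 => JetSup.equiv _ _ _ A' (bondEquiv F K b)))) A (single115 bb X) y‖ ≤ gC y bb * ‖A‖ * ‖X‖)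
    {G : ℝ} (hG : ∀ bb : Bond 3 (periodsT3 F K), ∑ y : PBond (F.P n) 0, gC y bb ≤ G) (hq : (εC + aC) * ΘH * G ≤ 1 / 2)
    (haC : 0 < aC) {A' : Space115 (F.L : ℝ) (((F.L : ℝ)⁻¹) ^ (K - n)) (fun _ : Bond 3 (periodsT3 F K) => K - n) (fun _ : Bond 3 (periodsT3 F K) × Fin 3 => K - n) (nabla115 (((F.L : ℝ)⁻¹) ^ (K - n)) (bgOfCfg F K U₀))} (hA' : ‖A'‖ < aC) (bb : Bond 3 (periodsT3 F K)) :
    ∑ b' : Bond 3 (periodsT3 F K), levWeight (F.L : ℝ) (((F.L : ℝ)⁻¹) ^ (K - n)) (fun _ : Bond 3 (periodsT3 F K) => K - n) 3 bb / levWeight (F.L : ℝ) (((F.L : ℝ)⁻¹) ^ (K - n)) (fun _ : Bond 3 (periodsT3 F K) => K - n) 3 b' * ‖kernel (fderiv ℂ (E3 (H1f F n K h c₀ cB aa (DeltaPiSlotP F n K h c₀ cB aa) U₀) (fun A' : Space115 (F.L : ℝ) (((F.L : ℝ)⁻¹) ^ (K - n)) (fun _ : Bond 3 (periodsT3 F K)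 => K - n) (fun _ : Bond 3 (periodsT3 F K) × Fin 3 => K - n) (nabla115 (((F.L : ℝ)⁻¹) ^ (K - n)) (bgOfCfg F K U₀)) =>
          (-Complex.I) • CmapTwS F n K h U₀ (((((eta F n K : ℝ) : ℂ)) * Complex.I) • (fun b : PBond (F.P K) 0 => JetSup.equiv _ _ _ A' (bondEquiv F K b)))) εC) A') b' bb‖
      ≤ ((2 * (1 / (1 - 4 * bH * C₂ * (εC + aC))) + 1) * ΘH * G / aC) * ‖A'‖ ^ 2 := by
  have hL0 : (F.L : ℝ) ≠ 0 := ne_of_gt Fact.out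
  have hw : ∀ (s : ℕ) (b : Bond 3 (periodsT3 F K)), levWeight (F.L : ℝ) (((F.L : ℝ)⁻¹) ^ (K - n)) (fun _ : Bond 3 (periodsT3 F K) => K - n) s b = 1 := fun s b => levWeight_member_eq_one hL0 (K - n) s b
  have hHw : ∀ (bb : Bond 3 (periodsT3 F K)) (y : PBond (F.P n) 0), ∑ b' : Bond 3 (periodsT3 F K), levWeight (F.L : ℝ) (((F.L : ℝ)⁻¹) ^ (K - n)) (fun _ : Bond 3 (periodsT3 F K) => K - n) 3 bb / levWeight (F.L : ℝ) (((F.L : ℝ)⁻¹) ^ (K - n)) (fun _ : Bond 3 (periodsT3 F K) => K - n) 3 b' * hk b' y ≤ ΘH := by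
    intro bb y; simp_rw [hw, div_one, one_mul]; exact hH1 y
  exact theta3_row (fun _ : PBond (F.P n) 0 => K - n) RC hC hk0 hHk hΘH hH1 hΘH hHw hgC0 hCg hG hq haC hA' bb

/-- ★★ **ROW `hΘ′` AT THE MEMBER** from the member's letters plus the one-block letter of the composite `Δ̃π∘H̃ᴾ` (`Θ_Δ` the member's number): `θE′ = 2Θ_ΔGℓ`.
[cite: Balaban1985Variational, (70)–(73) pp.288–289, (86)–(88) p.291] -/
theorem thetaPrime_member
    (F : T3Family) (n K : ℕ) (h : n ≤ K) [Fact (0 < (F.L : ℝ))] [Fact (0 < ((F.L : ℝ)⁻¹) ^ (K - n))]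
    (c₀ cB aa : ℝ) [Fact (0 < c₀)] [Fact (0 < cB)] (U₀ : GaugeField (F.P K) 0 (Matrix.specialUnitaryGroup (Fin 2) ℂ))
    {bH C₂ c₄ aC εC : ℝ}
    (RC : Regime (H1f F n K h c₀ cB aa (DeltaPiSlotP F n K h c₀ cB aa) U₀) 0
        (fun A' : Space115 (F.L : ℝ) (((F.L : ℝ)⁻¹) ^ (K - n)) (fun _ : Bond 3 (periodsT3 F K) => K - n) (fun _ : Bond 3 (periodsT3 F K) × Fin 3 => K - n) (nabla115 (((F.L : ℝ)⁻¹) ^ (K - n)) (bgOfCfg F K U₀)) =>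
          (-Complex.I) • CmapTwS F n K h U₀ (((((eta F n K : ℝ) : ℂ)) * Complex.I) • (fun b : PBond (F.P K) 0 => JetSup.equiv _ _ _ A' (bondEquiv F K b))))
        bH 0 C₂ c₄ 0 aC εC)
    (hC : Prop4Hyp
        (fun A' : Space115 (F.L : ℝ) (((F.L : ℝ)⁻¹) ^ (K - n)) (fun _ : Bond 3 (periodsT3 F K) => K - n) (fun _ : Bond 3 (periodsT3 F K) × Fin 3 => K - n) (nabla115 (((F.L : ℝ)⁻¹) ^ (K - n)) (bgOfCfg F K U₀)) =>
          (-Complex.I) • CmapTwS F n K h U₀ (((((eta F n K : ℝ) : ℂ)) * Complex.I) • (fun b : PBond (F.P K) 0 => JetSup.equiv _ _ _ A' (bondEquiv F K b)))) C₂ c₄)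
    {hk : Bond 3 (periodsT3 F K) → PBond (F.P n) 0 → ℝ} (hk0 : ∀ b' y, 0 ≤ hk b' y)
    (hHk : ∀ (y : PBond (F.P n) 0) (Z : Matrix (Fin 2) (Fin 2) ℂ) (b' : Bond 3 (periodsT3 F K)), ‖flat115 ((H1f F n K h c₀ cB aa (DeltaPiSlotP F n K h c₀ cB aa) U₀) (Pi.single y Z)) b'‖ ≤ hk b' y * ‖Z‖)
    {ΘH : ℝ} (hΘH : 0 ≤ ΘH) (hH1 : ∀ y : PBond (F.P n) 0, ∑ b' : Bond 3 (periodsT3 F K), hk b' y ≤ ΘH)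
    {gC : PBond (F.P n) 0 → Bond 3 (periodsT3 F K) → ℝ} (hgC0 : ∀ y bb, 0 ≤ gC y bb)
    (hCg : ∀ A : Space115 (F.L : ℝ) (((F.L : ℝ)⁻¹) ^ (K - n)) (fun _ : Bond 3 (periodsT3 F K) => K - n) (fun _ : Bond 3 (periodsT3 F K) × Fin 3 => K - n) (nabla115 (((F.L : ℝ)⁻¹) ^ (K - n)) (bgOfCfg F K U₀)), ‖A‖ < εC + aC → ∀ (bb : Bond 3 (periodsT3 F K)) (X : Matrix (Fin 2) (Fin 2) ℂ) (y : PBond (F.P n) 0),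
      ‖fderiv ℂ (fun A' : Space115 (F.L : ℝ) (((F.L : ℝ)⁻¹) ^ (K - n)) (fun _ : Bond 3 (periodsT3 F K) => K - n) (fun _ : Bond 3 (periodsT3 F K) × Fin 3 => K - n) (nabla115 (((F.L : ℝ)⁻¹) ^ (K - n)) (bgOfCfg F K U₀)) =>
          (-Complex.I) • CmapTwS F n K h U₀ (((((eta F n K : ℝ) : ℂ)) * Complex.I) • (fun b : PBond (F.P K) 0 => JetSup.equiv _ _ _ A' (bondEquiv F K b)))) A (single115 bb X) y‖ ≤ gC y bb * ‖A‖ * ‖X‖)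
    {G : ℝ} (hG : ∀ bb : Bond 3 (periodsT3 F K), ∑ y : PBond (F.P n) 0, gC y bb ≤ G) (hq : (εC + aC) * ΘH * G ≤ 1 / 2)
    {hk' : Bond 3 (periodsT3 F K) → PBond (F.P n) 0 → ℝ} (hk'0 : ∀ b' y, 0 ≤ hk' b' y)
    (hNk : ∀ (y : PBond (F.P n) 0) (Z : Matrix (Fin 2) (Fin 2) ℂ) (b' : Bond 3 (periodsT3 F K)), ‖NegSup.equiv (levWeight (F.L : ℝ) (((F.L : ℝ)⁻¹) ^ (K - n)) (fun _ : Bond 3 (periodsT3 F K) => K - n) 3) (Matrix (Fin 2) (Fin 2) ℂ) ((currentCLM frobEquiv (fun _ : Bond 3 (periodsT3 F K) × Fin 3 => K - n) (nabla115 (((F.L : ℝ)⁻¹) ^ (K - n)) (bgOfCfg F K U₀)) (DeltaEtaSlot F n K c₀ U₀)) ((H1f F n K h c₀ cB aa (DeltaPiSlotP F n K h c₀ cB aa) U₀) (Pi.single y Z))) b'‖ ≤ hk' b' y * ‖Z‖)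
    {ΘΔ : ℝ} (hΘΔ : 0 ≤ ΘΔ) (hΔ1 : ∀ y : PBond (F.P n) 0, ∑ b' : Bond 3 (periodsT3 F K), hk' b' y ≤ ΘΔ)
    {A' : Space115 (F.L : ℝ) (((F.L : ℝ)⁻¹) ^ (K - n)) (fun _ : Bond 3 (periodsT3 F K) => K - n) (fun _ : Bond 3 (periodsT3 F K) × Fin 3 => K - n) (nabla115 (((F.L : ℝ)⁻¹) ^ (K - n)) (bgOfCfg F K U₀))} (hA' : ‖A'‖ < aC) (bb : Bond 3 (periodsT3 F K)) (X : Matrix (Fin 2) (Fin 2) ℂ) :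
    ∑ b' : Bond 3 (periodsT3 F K), levWeight (F.L : ℝ) (((F.L : ℝ)⁻¹) ^ (K - n)) (fun _ : Bond 3 (periodsT3 F K) => K - n) 3 bb / levWeight (F.L : ℝ) (((F.L : ℝ)⁻¹) ^ (K - n)) (fun _ : Bond 3 (periodsT3 F K) => K - n) 1 b'
        * ‖NegSup.equiv (levWeight (F.L : ℝ) (((F.L : ℝ)⁻¹) ^ (K - n)) (fun _ : Bond 3 (periodsT3 F K) => K - n) 3) (Matrix (Fin 2) (Fin 2) ℂ) ((currentCLM frobEquiv (fun _ : Bond 3 (periodsT3 F K) × Fin 3 => K - n) (nabla115 (((F.L : ℝ)⁻¹) ^ (K - n)) (bgOfCfg F K U₀)) (DeltaEtaSlot F n K c₀ U₀)) ((fderiv ℂ (Emap (H1f F n K h c₀ cB aa (DeltaPiSlotP F n K h c₀ cB aa) U₀) (fun A' : Space115 (F.L : ℝ) (((F.L : ℝ)⁻¹) ^ (K - n)) (fun _ : Bond 3 (periodsT3 F K) => K - n) (fun _ : Bond 3 (periodsT3 F K) × Fin 3 => K - n) (nabla115 (((F.L : ℝ)⁻¹) ^ (K - n)) (bgOfCfg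 F K U₀)) =>
          (-Complex.I) • CmapTwS F n K h U₀ (((((eta F n K : ℝ) : ℂ)) * Complex.I) • (fun b : PBond (F.P K) 0 => JetSup.equiv _ _ _ A' (bondEquiv F K b)))) εC) A') (single115 bb X))) b'‖
      ≤ 2 * ΘΔ * G * (1 / (1 - 4 * bH * C₂ * (εC + aC))) * ‖A'‖ * ‖X‖ := by
  have hL0 : (F.L : ℝ) ≠ 0 := ne_of_gt Fact.out
  have hw : ∀ (s : ℕ) (b : Bond 3 (periodsT3 F K)), levWeight (F.L : ℝ) (((F.L : ℝ)⁻¹) ^ (K - n)) (fun _ : Bond 3 (periodsT3 F K) => K - n) s b = 1 := fun s b => levWeight_member_eq_one hL0 (K - n) s b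
  have hr : ∀ b' : Bond 3 (periodsT3 F K), 0 ≤ levWeight (F.L : ℝ) (((F.L : ℝ)⁻¹) ^ (K - n)) (fun _ : Bond 3 (periodsT3 F K) => K - n) 3 bb / levWeight (F.L : ℝ) (((F.L : ℝ)⁻¹) ^ (K - n)) (fun _ : Bond 3 (periodsT3 F K) => K - n) 1 b' := fun b' => by rw [hw, hw]; norm_num
  have hΘ' : ∀ y : PBond (F.P n) 0, ∑ b' : Bond 3 (periodsT3 F K), levWeight (F.L : ℝ) (((F.L : ℝ)⁻¹) ^ (K - n)) (fun _ : Bond 3 (periodsT3 F K) => K - n) 3 bb / levWeight (F.L : ℝ) (((F.L : ℝ)⁻¹) ^ (K - n)) (fun _ : Bond 3 (periodsT3 F K) => K - n) 1 b' * hk' b' y ≤ ΘΔ := by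
    intro y; simp_rw [hw, div_one, one_mul]; exact hΔ1 y
  exact thetaPrime_row (fun _ : PBond (F.P n) 0 => K - n) RC hC hk0 hHk hΘH hH1 hgC0 hCg hG hq (currentCLM frobEquiv (fun _ : Bond 3 (periodsT3 F K) × Fin 3 => K - n) (nabla115 (((F.L : ℝ)⁻¹) ^ (K - n)) (bgOfCfg F K U₀)) (DeltaEtaSlot F n K c₀ U₀)) hk'0 hNk bb hr hΘΔ hΘ' hA' X

/-! ## §2 ★★★ The door: the family rows from the three displayed letters -/


/-- ★★★ **«THETA-OF-W6»: ✓p683940's three displayed binders `hΘE ∧ hΘ′ ∧ hΘ3` (lit ✓`quadAnalytic_W80_composite` :189–195 at the (W-X′) letters of record) from the three one-block∕one-bond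
LETTER ROWS with the volume displayed, the Sect. C regime `hRC` (VERBATIM ✓p683940's), the numeric Neumann window `hqΘ`, and `θE θE′ θ₃` WRITTEN OUT:
`θE L = 2·ΘH L·G L·ℓ L`, `θE′ L = 2·ΘΔ L·G L·ℓ L`, `θ₃ L = (2ℓ L + 1)·(ΘH L·G L)∕a₃ L`, `ℓ L = 1∕(1 − 4·bH L·C₂(L)·(εC L + a₃ L))`.**
[cite: Balaban1985Variational, (63) p.287, (68)–(73) pp.288–289, (85)–(88) p.291, Prop. 4 (97)–(98) pp.292–293; Balaban1985BackgroundPropagators, (3.132)–(3.133) p.423; Balaban1985Averaging, (157) p.42] -/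
theorem theta_rows_family_of_columnLetters
    [hFL : ∀ F : T3Family, Fact (0 < (F.L : ℝ))] [hFη : ∀ (F : T3Family) (k : ℕ), Fact (0 < ((F.L : ℝ)⁻¹) ^ k)]
    (α a₃ ef εC bH ΘH ΘΔ G : ℕ → ℝ)
    (hα : ∀ L, 1 < L → 0 < α L) (ha₃ : ∀ L, 1 < L → 0 < a₃ L) (hef : ∀ L, 1 < L → 0 < ef L)
    (hWe : ∀ L : ℕ, 1 < L → 10 ^ 9 * (L : ℝ) ^ 2 * ef L ≤ 1) (hWε : ∀ L : ℕ, 1 < L → 10 ^ 12 * (L : ℝ) ^ 3 * α L ≤ 1)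
    (c₀ cB : ℕ → ℝ) [hc₀ : ∀ L : ℕ, Fact (0 < c₀ L)] [hcB : ∀ L : ℕ, Fact (0 < cB L)]
    (a : ∀ L : ℕ, Idx L → ℝ)
    -- signs and the ONE numeric Neumann window (the volume factors cancel in the product `ΘH·G`)
    (hΘH0 : ∀ L, 1 < L → 0 ≤ ΘH L) (hΘΔ0 : ∀ L, 1 < L → 0 ≤ ΘΔ L)
    (hqΘ : ∀ L, 1 < L → (εC L + a₃ L) * ΘH L * G L ≤ 1 / 2)
    -- ROW `hRC` — VERBATIM ✓p683940 (inhabited at `bH := B₀` by ✓p682625 `hRC_of_rows_family_B₀`)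
    (hRC : ∀ (L : ℕ), 1 < L → ∀ (i : Idx L) (U₀ : GaugeField (i.1.1.P i.1.2.2) 0 (Matrix.specialUnitaryGroup (Fin 2) ℂ)), RegPr i.1.1 i.1.2.1 i.1.2.2 (α L) U₀ →
      Regime (H1f i.1.1 i.1.2.1 i.1.2.2 i.2.2.le (c₀ L) (cB L) (a L i) (DeltaPiSlotP i.1.1 i.1.2.1 i.1.2.2 i.2.2.le (c₀ L) (cB L) (a L i)) U₀) 0
        (fun A' : Space115 (i.1.1.L : ℝ) (((i.1.1.L : ℝ)⁻¹) ^ (i.1.2.2 - i.1.2.1)) (fun _ : Bond 3 (periodsT3 i.1.1 i.1.2.2) => i.1.2.2 - i.1.2.1) (fun _ : Bond 3 (periodsT3 i.1.1 i.1.2.2) × Fin 3 => i.1.2.2 - i.1.2.1) (nabla115 (((i.1.1.L : ℝ)⁻¹) ^ (i.1.2.2 - i.1.2.1)) (bgOfCfg i.1.1 i.1.2.2 U₀)) =>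
          (-Complex.I) • CmapTwS i.1.1 i.1.2.1 i.1.2.2 i.2.2.le U₀ (((((eta i.1.1 i.1.2.1 i.1.2.2 : ℝ) : ℂ)) * Complex.I) • (fun b : PBond (i.1.1.P i.1.2.2) 0 => JetSup.equiv _ _ _ A' (bondEquiv i.1.1 i.1.2.2 b))))
        (bH L) 0 (40 * (2 * (3 * (2 * ef L + 2700 * (L : ℝ) * α L))) / ef L ^ 2) (ef L / 2) 0 (a₃ L) (εC L))
    -- ROW «H-COLUMN» ([5] (3.133)-class): the one-block letter of `H̃ᴾ` read on `Pi.single`, fine column sums `≤ ΘH L·(L^{K−n})³` (DISPLAYED, N06)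
    (hHcol : ∀ (L : ℕ), 1 < L → ∀ (i : Idx L) (U₀ : GaugeField (i.1.1.P i.1.2.2) 0 (Matrix.specialUnitaryGroup (Fin 2) ℂ)), RegPr i.1.1 i.1.2.1 i.1.2.2 (α L) U₀ →
      ∃ hk : Bond 3 (periodsT3 i.1.1 i.1.2.2) → PBond (i.1.1.P i.1.2.1) 0 → ℝ, (∀ b' y, 0 ≤ hk b' y) ∧
        (∀ (y : PBond (i.1.1.P i.1.2.1) 0) (Z : Matrix (Fin 2) (Fin 2) ℂ) (b' : Bond 3 (periodsT3 i.1.1 i.1.2.2)), ‖flat115 ((H1f i.1.1 i.1.2.1 i.1.2.2 i.2.2.le (c₀ L) (cB L) (a L i) (DeltaPiSlotP i.1.1 i.1.2.1 i.1.2.2 i.2.2.le (c₀ L) (cB L) (a L i)) U₀) (Pi.single y Z)) b'‖ ≤ hk b' y * ‖Z‖) ∧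
        (∀ y : PBond (i.1.1.P i.1.2.1) 0, ∑ b' : Bond 3 (periodsT3 i.1.1 i.1.2.2), hk b' y ≤ ΘH L * ((L : ℝ) ^ (i.1.2.2 - i.1.2.1)) ^ 3))
    -- ROW «C-COLUMN» ([4] (157)-class): the one-bond coarse-column letter of `C̃′` on `‖A‖ < εC + a₃`, column sums `≤ G L·((L^{K−n})³)⁻¹` (DISPLAYED; locality + count = ★px18 F2∕F3, entry = (157))
    (hCcol : ∀ (L : ℕ), 1 < L → ∀ (i : Idx L) (U₀ : GaugeField (i.1.1.P i.1.2.2) 0 (Matrix.specialUnitaryGroup (Fin 2) ℂ)), RegPr i.1.1 i.1.2.1 i.1.2.2 (α L) U₀ →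
      ∃ gC : PBond (i.1.1.P i.1.2.1) 0 → Bond 3 (periodsT3 i.1.1 i.1.2.2) → ℝ, (∀ y bb, 0 ≤ gC y bb) ∧
        (∀ A : Space115 (i.1.1.L : ℝ) (((i.1.1.L : ℝ)⁻¹) ^ (i.1.2.2 - i.1.2.1)) (fun _ : Bond 3 (periodsT3 i.1.1 i.1.2.2) => i.1.2.2 - i.1.2.1) (fun _ : Bond 3 (periodsT3 i.1.1 i.1.2.2) × Fin 3 => i.1.2.2 - i.1.2.1) (nabla115 (((i.1.1.L : ℝ)⁻¹) ^ (i.1.2.2 - i.1.2.1)) (bgOfCfg i.1.1 i.1.2.2 U₀)), ‖A‖ < εC L + a₃ L → ∀ (bb : Bond 3 (periodsT3 i.1.1 i.1.2.2)) (X : Matrix (Fin 2) (Fin 2) ℂ) (y : PBond (i.1.1.P i.1.2.1) 0),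
          ‖fderiv ℂ (fun A' : Space115 (i.1.1.L : ℝ) (((i.1.1.L : ℝ)⁻¹) ^ (i.1.2.2 - i.1.2.1)) (fun _ : Bond 3 (periodsT3 i.1.1 i.1.2.2) => i.1.2.2 - i.1.2.1) (fun _ : Bond 3 (periodsT3 i.1.1 i.1.2.2) × Fin 3 => i.1.2.2 - i.1.2.1) (nabla115 (((i.1.1.L : ℝ)⁻¹) ^ (i.1.2.2 - i.1.2.1)) (bgOfCfg i.1.1 i.1.2.2 U₀)) =>
          (-Complex.I) • CmapTwS i.1.1 i.1.2.1 i.1.2.2 i.2.2.le U₀ (((((eta i.1.1 i.1.2.1 i.1.2.2 : ℝ) : ℂ)) * Complex.I) • (fun b : PBond (i.1.1.P i.1.2.2) 0 => JetSup.equiv _ _ _ A' (bondEquiv i.1.1 i.1.2.2 b)))) A (single115 bb X) y‖ ≤ gC y bb * ‖A‖ * ‖X‖) ∧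
        (∀ bb : Bond 3 (periodsT3 i.1.1 i.1.2.2), ∑ y : PBond (i.1.1.P i.1.2.1) 0, gC y bb ≤ G L * (((L : ℝ) ^ (i.1.2.2 - i.1.2.1)) ^ 3)⁻¹))
    -- ROW «ΔH-COLUMN» ([B11] (88) + [5] (3.133)-class): the one-block letter of `Δ̃π ∘ H̃ᴾ`, fine column sums `≤ ΘΔ L·(L^{K−n})³` (DISPLAYED, N06)
    (hΔHcol : ∀ (L : ℕ), 1 < L → ∀ (i : Idx L) (U₀ : GaugeField (i.1.1.P i.1.2.2) 0 (Matrix.specialUnitaryGroup (Fin 2) ℂ)), RegPr i.1.1 i.1.2.1 i.1.2.2 (α L) U₀ →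
      ∃ hk' : Bond 3 (periodsT3 i.1.1 i.1.2.2) → PBond (i.1.1.P i.1.2.1) 0 → ℝ, (∀ b' y, 0 ≤ hk' b' y) ∧
        (∀ (y : PBond (i.1.1.P i.1.2.1) 0) (Z : Matrix (Fin 2) (Fin 2) ℂ) (b' : Bond 3 (periodsT3 i.1.1 i.1.2.2)), ‖NegSup.equiv (levWeight (i.1.1.L : ℝ) (((i.1.1.L : ℝ)⁻¹) ^ (i.1.2.2 - i.1.2.1)) (fun _ : Bond 3 (periodsT3 i.1.1 i.1.2.2) => i.1.2.2 - i.1.2.1) 3) (Matrix (Fin 2) (Fin 2) ℂ) ((currentCLM frobEquiv (fun _ : Bond 3 (periodsT3 i.1.1 i.1.2.2) × Fin 3 => i.1.2.2 - i.1.2.1) (nabla115 (((i.1.1.L : ℝ)⁻¹) ^ (i.1.2.2 - i.1.2.1)) (bgOfCfg i.1.1 i.1.2.2 U₀)) (DeltaEtaSlot i.1.1 i.1.2.1 i.1.2.2 (c₀ L) U₀)) ((H1f i.1.1 i.1.2.1 i.1.2.2 i.2.2.le (c₀ L) (cB L) (a L i) (DeltaPiSlotP i.1.1 i.1.2.1 i.1.2.2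 i.2.2.le (c₀ L) (cB L) (a L i)) U₀) (Pi.single y Z))) b'‖ ≤ hk' b' y * ‖Z‖) ∧
        (∀ y : PBond (i.1.1.P i.1.2.1) 0, ∑ b' : Bond 3 (periodsT3 i.1.1 i.1.2.2), hk' b' y ≤ ΘΔ L * ((L : ℝ) ^ (i.1.2.2 - i.1.2.1)) ^ 3)) :
    -- CONCLUSION = ✓p683940's binders `hΘE`, `hΘ′`, `hΘ3` VERBATIM at the written-out `θE θE′ θ₃`
    (∀ (L : ℕ), 1 < L → ∀ (i : Idx L) (U₀ : GaugeField (i.1.1.P i.1.2.2) 0 (Matrix.specialUnitaryGroup (Fin 2) ℂ)), RegPr i.1.1 i.1.2.1 i.1.2.2 (α L) U₀ →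
      ∀ A' : Space115 (i.1.1.L : ℝ) (((i.1.1.L : ℝ)⁻¹) ^ (i.1.2.2 - i.1.2.1)) (fun _ : Bond 3 (periodsT3 i.1.1 i.1.2.2) => i.1.2.2 - i.1.2.1) (fun _ : Bond 3 (periodsT3 i.1.1 i.1.2.2) × Fin 3 => i.1.2.2 - i.1.2.1) (nabla115 (((i.1.1.L : ℝ)⁻¹) ^ (i.1.2.2 - i.1.2.1)) (bgOfCfg i.1.1 i.1.2.2 U₀)), ‖A'‖ < a₃ L → ∀ bb : Bond 3 (periodsT3 i.1.1 i.1.2.2), ∑ b' : Bond 3 (periodsT3 i.1.1 i.1.2.2),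
        levWeight (i.1.1.L : ℝ) (((i.1.1.L : ℝ)⁻¹) ^ (i.1.2.2 - i.1.2.1)) (fun _ : Bond 3 (periodsT3 i.1.1 i.1.2.2) => i.1.2.2 - i.1.2.1) 3 bb / levWeight (i.1.1.L : ℝ) (((i.1.1.L : ℝ)⁻¹) ^ (i.1.2.2 - i.1.2.1)) (fun _ : Bond 3 (periodsT3 i.1.1 i.1.2.2) => i.1.2.2 - i.1.2.1) 3 b' * ‖kernel (fderiv ℂ (Emap (H1f i.1.1 i.1.2.1 i.1.2.2 i.2.2.le (c₀ L) (cB L) (a L i) (DeltaPiSlotP i.1.1 i.1.2.1 i.1.2.2 i.2.2.le (c₀ L) (cB L) (a L i)) U₀) (fun A' : Space115 (i.1.1.L : ℝ) (((i.1.1.L : ℝ)⁻¹) ^ (i.1.2.2 - i.1.2.1)) (fun _ : Bond 3 (periodsT3 i.1.1 i.1.2.2) => i.1.2.2 - i.1.2.1) (fun _ : Bond 3 (periodsT3 i.1.1 i.1.2.2) × Fin 3 => i.1.2.2 - i.1.2.1) (nabla115 (((i.1.1.L : ℝ)⁻¹) ^ (i.1.2.2 - i.1.2.1)) (bgOfCfg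 i.1.1 i.1.2.2 U₀)) =>
          (-Complex.I) • CmapTwS i.1.1 i.1.2.1 i.1.2.2 i.2.2.le U₀ (((((eta i.1.1 i.1.2.1 i.1.2.2 : ℝ) : ℂ)) * Complex.I) • (fun b : PBond (i.1.1.P i.1.2.2) 0 => JetSup.equiv _ _ _ A' (bondEquiv i.1.1 i.1.2.2 b)))) (εC L)) A') b' bb‖ ≤ (2 * ΘH L * G L * (1 / (1 - 4 * bH L * (40 * (2 * (3 * (2 * ef L + 2700 * (L : ℝ) * α L))) / ef L ^ 2) * (εC L + a₃ L)))) * ‖A'‖) ∧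
    (∀ (L : ℕ), 1 < L → ∀ (i : Idx L) (U₀ : GaugeField (i.1.1.P i.1.2.2) 0 (Matrix.specialUnitaryGroup (Fin 2) ℂ)), RegPr i.1.1 i.1.2.1 i.1.2.2 (α L) U₀ →
      ∀ A' : Space115 (i.1.1.L : ℝ) (((i.1.1.L : ℝ)⁻¹) ^ (i.1.2.2 - i.1.2.1)) (fun _ : Bond 3 (periodsT3 i.1.1 i.1.2.2) => i.1.2.2 - i.1.2.1) (fun _ : Bond 3 (periodsT3 i.1.1 i.1.2.2) × Fin 3 => i.1.2.2 - i.1.2.1) (nabla115 (((i.1.1.L : ℝ)⁻¹) ^ (i.1.2.2 - i.1.2.1)) (bgOfCfg i.1.1 i.1.2.2 U₀)), ‖A'‖ < a₃ L → ∀ (bb : Bond 3 (periodsT3 i.1.1 i.1.2.2)) (X : Matrix (Fin 2) (Fin 2) ℂ), ∑ b' : Bond 3 (periodsT3 i.1.1 i.1.2.2),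
        levWeight (i.1.1.L : ℝ) (((i.1.1.L : ℝ)⁻¹) ^ (i.1.2.2 - i.1.2.1)) (fun _ : Bond 3 (periodsT3 i.1.1 i.1.2.2) => i.1.2.2 - i.1.2.1) 3 bb / levWeight (i.1.1.L : ℝ) (((i.1.1.L : ℝ)⁻¹) ^ (i.1.2.2 - i.1.2.1)) (fun _ : Bond 3 (periodsT3 i.1.1 i.1.2.2) => i.1.2.2 - i.1.2.1) 1 b'
          * ‖NegSup.equiv (levWeight (i.1.1.L : ℝ) (((i.1.1.L : ℝ)⁻¹) ^ (i.1.2.2 - i.1.2.1)) (fun _ : Bond 3 (periodsT3 i.1.1 i.1.2.2) => i.1.2.2 - i.1.2.1) 3) (Matrix (Fin 2) (Fin 2) ℂ) ((currentCLM frobEquiv (fun _ : Bond 3 (periodsT3 i.1.1 i.1.2.2) × Fin 3 => i.1.2.2 - i.1.2.1) (nabla115 (((i.1.1.L : ℝ)⁻¹) ^ (i.1.2.2 - i.1.2.1)) (bgOfCfg i.1.1 i.1.2.2 U₀)) (DeltaEtaSlot i.1.1 i.1.2.1 i.1.2.2 (c₀ L) U₀)) ((fderiv ℂ (Emap (H1f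 i.1.1 i.1.2.1 i.1.2.2 i.2.2.le (c₀ L) (cB L) (a L i) (DeltaPiSlotP i.1.1 i.1.2.1 i.1.2.2 i.2.2.le (c₀ L) (cB L) (a L i)) U₀) (fun A' : Space115 (i.1.1.L : ℝ) (((i.1.1.L : ℝ)⁻¹) ^ (i.1.2.2 - i.1.2.1)) (fun _ : Bond 3 (periodsT3 i.1.1 i.1.2.2) => i.1.2.2 - i.1.2.1) (fun _ : Bond 3 (periodsT3 i.1.1 i.1.2.2) × Fin 3 => i.1.2.2 - i.1.2.1) (nabla115 (((i.1.1.L : ℝ)⁻¹) ^ (i.1.2.2 - i.1.2.1)) (bgOfCfg i.1.1 i.1.2.2 U₀)) =>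
          (-Complex.I) • CmapTwS i.1.1 i.1.2.1 i.1.2.2 i.2.2.le U₀ (((((eta i.1.1 i.1.2.1 i.1.2.2 : ℝ) : ℂ)) * Complex.I) • (fun b : PBond (i.1.1.P i.1.2.2) 0 => JetSup.equiv _ _ _ A' (bondEquiv i.1.1 i.1.2.2 b)))) (εC L)) A') (single115 bb X))) b'‖ ≤ (2 * ΘΔ L * G L * (1 / (1 - 4 * bH L * (40 * (2 * (3 * (2 * ef L + 2700 * (L : ℝ) * α L))) / ef L ^ 2) * (εC L + a₃ L)))) * ‖A'‖ * ‖X‖) ∧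
    (∀ (L : ℕ), 1 < L → ∀ (i : Idx L) (U₀ : GaugeField (i.1.1.P i.1.2.2) 0 (Matrix.specialUnitaryGroup (Fin 2) ℂ)), RegPr i.1.1 i.1.2.1 i.1.2.2 (α L) U₀ →
      ∀ A' : Space115 (i.1.1.L : ℝ) (((i.1.1.L : ℝ)⁻¹) ^ (i.1.2.2 - i.1.2.1)) (fun _ : Bond 3 (periodsT3 i.1.1 i.1.2.2) => i.1.2.2 - i.1.2.1) (fun _ : Bond 3 (periodsT3 i.1.1 i.1.2.2) × Fin 3 => i.1.2.2 - i.1.2.1) (nabla115 (((i.1.1.L : ℝ)⁻¹) ^ (i.1.2.2 - i.1.2.1)) (bgOfCfg i.1.1 i.1.2.2 U₀)), ‖A'‖ < a₃ L → ∀ bb : Bond 3 (periodsT3 i.1.1 i.1.2.2), ∑ b' : Bond 3 (periodsT3 i.1.1 i.1.2.2),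
        levWeight (i.1.1.L : ℝ) (((i.1.1.L : ℝ)⁻¹) ^ (i.1.2.2 - i.1.2.1)) (fun _ : Bond 3 (periodsT3 i.1.1 i.1.2.2) => i.1.2.2 - i.1.2.1) 3 bb / levWeight (i.1.1.L : ℝ) (((i.1.1.L : ℝ)⁻¹) ^ (i.1.2.2 - i.1.2.1)) (fun _ : Bond 3 (periodsT3 i.1.1 i.1.2.2) => i.1.2.2 - i.1.2.1) 3 b' * ‖kernel (fderiv ℂ (E3 (H1f i.1.1 i.1.2.1 i.1.2.2 i.2.2.le (c₀ L) (cB L) (a L i) (DeltaPiSlotP i.1.1 i.1.2.1 i.1.2.2 i.2.2.le (c₀ L) (cB L) (a L i)) U₀) (fun A' : Space115 (i.1.1.L : ℝ) (((i.1.1.L : ℝ)⁻¹) ^ (i.1.2.2 - i.1.2.1)) (fun _ : Bond 3 (periodsT3 i.1.1 i.1.2.2) => i.1.2.2 - i.1.2.1) (fun _ : Bond 3 (periodsT3 i.1.1 i.1.2.2) × Fin 3 => i.1.2.2 - i.1.2.1) (nabla115 (((i.1.1.L : ℝ)⁻¹) ^ (i.1.2.2 - i.1.2.1)) (bgOfCfg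 i.1.1 i.1.2.2 U₀)) =>
          (-Complex.I) • CmapTwS i.1.1 i.1.2.1 i.1.2.2 i.2.2.le U₀ (((((eta i.1.1 i.1.2.1 i.1.2.2 : ℝ) : ℂ)) * Complex.I) • (fun b : PBond (i.1.1.P i.1.2.2) 0 => JetSup.equiv _ _ _ A' (bondEquiv i.1.1 i.1.2.2 b)))) (εC L)) A') b' bb‖ ≤ ((2 * (1 / (1 - 4 * bH L * (40 * (2 * (3 * (2 * ef L + 2700 * (L : ℝ) * α L))) / ef L ^ 2) * (εC L + a₃ L))) + 1) * (ΘH L * G L) / a₃ L) * ‖A'‖ ^ 2) := by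
  -- per member: the common setup
  have setup : ∀ (L : ℕ) (hL : 1 < L) (i : Idx L) (U₀ : GaugeField (i.1.1.P i.1.2.2) 0 (Matrix.specialUnitaryGroup (Fin 2) ℂ))
      (hregα : RegPr i.1.1 i.1.2.1 i.1.2.2 (α L) U₀),
      (L : ℝ) = (i.1.1.L : ℝ) ∧ ((L : ℝ) ^ (i.1.2.2 - i.1.2.1)) ^ 3 ≠ 0 ∧
      Prop4Hyp (fun A' : Space115 (i.1.1.L : ℝ) (((i.1.1.L : ℝ)⁻¹) ^ (i.1.2.2 - i.1.2.1)) (fun _ : Bond 3 (periodsT3 i.1.1 i.1.2.2) => i.1.2.2 - i.1.2.1) (fun _ : Bond 3 (periodsT3 i.1.1 i.1.2.2) × Fin 3 => i.1.2.2 - i.1.2.1) (nabla115 (((i.1.1.L : ℝ)⁻¹) ^ (i.1.2.2 - i.1.2.1)) (bgOfCfg i.1.1 i.1.2.2 U₀)) =>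
          (-Complex.I) • CmapTwS i.1.1 i.1.2.1 i.1.2.2 i.2.2.le U₀ (((((eta i.1.1 i.1.2.1 i.1.2.2 : ℝ) : ℂ)) * Complex.I) • (fun b : PBond (i.1.1.P i.1.2.2) 0 => JetSup.equiv _ _ _ A' (bondEquiv i.1.1 i.1.2.2 b)))) (40 * (2 * (3 * (2 * ef L + 2700 * (L : ℝ) * α L))) / ef L ^ 2) (ef L / 2) := by
    intro L hL i U₀ hregα
    have hLi : (L : ℝ) = (i.1.1.L : ℝ) := by rw [i.2.1]
    have hL0 : (0 : ℝ) < (L : ℝ) := by exact_mod_cast (lt_trans Nat.zero_lt_one hL)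
    refine ⟨hLi, pow_ne_zero _ (pow_ne_zero _ hL0.ne'), ?_⟩
    have hWe' : 10 ^ 9 * (i.1.1.L : ℝ) ^ 2 * ef L ≤ 1 := by rw [← hLi]; exact hWe L hL
    have hWε' : 10 ^ 12 * (i.1.1.L : ℝ) ^ 3 * α L ≤ 1 := by rw [← hLi]; exact hWε L hL
    rw [hLi]
    exact prop4Hyp_CmapTwS_conj_zeroJet i.1.1 i.2.2.le (hα L hL) (hef L hL) hWe' hWε' U₀ hregα
  -- the product of the two displayed volume letters is the L-only product
  have hprod : ∀ (L : ℕ) (i : Idx L) (x y : ℝ), ((L : ℝ) ^ (i.1.2.2 - i.1.2.1)) ^ 3 ≠ 0 →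
      x * ((L : ℝ) ^ (i.1.2.2 - i.1.2.1)) ^ 3 * (y * (((L : ℝ) ^ (i.1.2.2 - i.1.2.1)) ^ 3)⁻¹) = x * y := by
    intro L i x y hV
    rw [mul_mul_mul_comm, mul_inv_cancel₀ hV, mul_one]
  refine ⟨?_, ?_, ?_⟩
  · intro L hL i U₀ hregα A' hA' bb
    obtain ⟨hLi, hV, hC⟩ := setup L hL i U₀ hregα
    obtain ⟨hk, hk0, hHk, hH1⟩ := hHcol L hL i U₀ hregα
    obtain ⟨gC, hgC0, hCg, hG⟩ := hCcol L hL i U₀ hregα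
    have hΘHV : 0 ≤ ΘH L * ((L : ℝ) ^ (i.1.2.2 - i.1.2.1)) ^ 3 := mul_nonneg (hΘH0 L hL) (pow_nonneg (pow_nonneg (Nat.cast_nonneg L) _) 3)
    have hq : (εC L + a₃ L) * (ΘH L * ((L : ℝ) ^ (i.1.2.2 - i.1.2.1)) ^ 3) * (G L * (((L : ℝ) ^ (i.1.2.2 - i.1.2.1)) ^ 3)⁻¹) ≤ 1 / 2 := by
      rw [mul_assoc, hprod L i _ _ hV, ← mul_assoc]; exact hqΘ L hL
    have h := thetaE_member i.1.1 i.1.2.1 i.1.2.2 i.2.2.le (c₀ L) (cB L) (a L i) U₀ (hRC L hL i U₀ hregα) hC hk0 hHk hΘHV hH1 hgC0 hCg hG hq hA' bb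
    refine h.trans (le_of_eq ?_)
    rw [mul_assoc (2 : ℝ), hprod L i _ _ hV, ← mul_assoc]
  · intro L hL i U₀ hregα A' hA' bb X
    obtain ⟨hLi, hV, hC⟩ := setup L hL i U₀ hregα
    obtain ⟨hk, hk0, hHk, hH1⟩ := hHcol L hL i U₀ hregα
    obtain ⟨gC, hgC0, hCg, hG⟩ := hCcol L hL i U₀ hregα
    obtain ⟨hk', hk'0, hNk, hΔ1⟩ := hΔHcol L hL i U₀ hregα
    have hΘHV : 0 ≤ ΘH L * ((L : ℝ) ^ (i.1.2.2 - i.1.2.1)) ^ 3 := mul_nonneg (hΘH0 L hL) (pow_nonneg (pow_nonneg (Nat.cast_nonneg L) _) 3)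
    have hΘΔV : 0 ≤ ΘΔ L * ((L : ℝ) ^ (i.1.2.2 - i.1.2.1)) ^ 3 := mul_nonneg (hΘΔ0 L hL) (pow_nonneg (pow_nonneg (Nat.cast_nonneg L) _) 3)
    have hq : (εC L + a₃ L) * (ΘH L * ((L : ℝ) ^ (i.1.2.2 - i.1.2.1)) ^ 3) * (G L * (((L : ℝ) ^ (i.1.2.2 - i.1.2.1)) ^ 3)⁻¹) ≤ 1 / 2 := by
      rw [mul_assoc, hprod L i _ _ hV, ← mul_assoc]; exact hqΘ L hL
    have h := thetaPrime_member i.1.1 i.1.2.1 i.1.2.2 i.2.2.le (c₀ L) (cB L) (a L i) U₀ (hRC L hL i U₀ hregα) hC hk0 hHk hΘHV hH1 hgC0 hCg hG hq hk'0 hNk hΘΔV hΔ1 hA' bb X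
    refine h.trans (le_of_eq ?_)
    rw [mul_assoc (2 : ℝ), hprod L i _ _ hV, ← mul_assoc]
  · intro L hL i U₀ hregα A' hA' bb
    obtain ⟨hLi, hV, hC⟩ := setup L hL i U₀ hregα
    obtain ⟨hk, hk0, hHk, hH1⟩ := hHcol L hL i U₀ hregα
    obtain ⟨gC, hgC0, hCg, hG⟩ := hCcol L hL i U₀ hregα
    have hΘHV : 0 ≤ ΘH L * ((L : ℝ) ^ (i.1.2.2 - i.1.2.1)) ^ 3 := mul_nonneg (hΘH0 L hL) (pow_nonneg (pow_nonneg (Nat.cast_nonneg L) _) 3)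
    have hq : (εC L + a₃ L) * (ΘH L * ((L : ℝ) ^ (i.1.2.2 - i.1.2.1)) ^ 3) * (G L * (((L : ℝ) ^ (i.1.2.2 - i.1.2.1)) ^ 3)⁻¹) ≤ 1 / 2 := by
      rw [mul_assoc, hprod L i _ _ hV, ← mul_assoc]; exact hqΘ L hL
    have h := theta3_member i.1.1 i.1.2.1 i.1.2.2 i.2.2.le (c₀ L) (cB L) (a L i) U₀ (hRC L hL i U₀ hregα) hC hk0 hHk hΘHV hH1 hgC0 hCg hG hq (ha₃ L hL) hA' bb
    refine h.trans (le_of_eq ?_)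
    rw [mul_assoc (2 * (1 / (1 - 4 * bH L * (40 * (2 * (3 * (2 * ef L + 2700 * (L : ℝ) * α L))) / ef L ^ 2) * (εC L + a₃ L))) + 1), hprod L i _ _ hV]

end Summit.QuantumFields.YangMills.Theorems.Prop7ThetaOfColumnLettersT3

end
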